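import Literature.Computability.Complexity.CliqueApproximators
import HarnessLib

/-!
# Razborov's approximation method for CLIQUE-like functions: the wide regime `l < s - 1`

`CliqueApproximators.lean` runs Razborov's approximation method in the Alon–Boppana lattice
`K(m, r, l)` under the restriction `s = l + 1` (clique size one more than the cardinality bound
of the lattice), which is what the quasi-polynomial bound `m^{Ω(log m)}` for small cliques
needs (`razborov_dichotomy`, `razborov_alon_boppana_holds`). Exponential bounds
(Alon–Boppana 1987, §3.3–3.4, cliques of polynomial size `s` with `l ≈ √s`; Jukna 2012,
Thm. 9.26) need the lattice parameter `l` much smaller than `s`. Everything in this file is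
PROVED; it generalizes the three statements of `CliqueApproximators.lean` that mention
`s = l + 1` to `l < s`, the only change being the count of cliques lost at an AND gate:

* `card_errPos_le_wide` — **Alon–Boppana 1987, Lemma 3.13 (first half of its proof)** for
  `l < s`: an `s`-clique lost at an approximate AND gate `⌈A⌉ ∧ ⌈B⌉ ↦ ⌈A ∩ B⌉` contains
  `X ∪ Y` for minimal members `X ∈ A`, `Y ∈ B` with `|X ∪ Y| > l` (otherwise
  `X ∪ Y ∈ A ∩ B`), so there are at most `|min A| · |min B| · C(m - l - 1, s - l - 1) ≤
  ((r-1)^l)^2 · C(m - l - 1, s - l - 1)` of them (Cor. 3.3; the printed Lemma 3.13 sharpens the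
  factor `((r-1)^l)^2` to `2^s (r-1)^s`-type bounds, which we do not need).
* `exists_rApprox_gates_wide`, `exists_rApprox_circuit_wide` — Theorem 2.1 along a program, with
  this count.
* `razborov_dichotomy_wide` — for a monotone circuit of size `t` computing a function that
  accepts all `s`-cliques and rejects all complete `g`-partite graphs, `2 ≤ r`, `2 ≤ l < s`:
  either `g^m (g^l)^r ≤ t · |𝒱(l)| · (g^l - g(g-1)⋯(g-l+1))^r · g^m`, or
  `C(m, s) ≤ t · ((r-1)^l)^2 · C(m-l-1, s-l-1) + Σ_{k=2}^{l} (r-1)^k C(m-k, s-k)`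
  (Alon–Boppana 1987, proof of Lemma 3.14 / §3.4, constants not optimised).

These serve the exponential lower bound for `(k-1, k)`-clique functions with `k = ⌊√m⌋`
(`Literature.Barriers.PneNP.Jukna2012_cliqueLike_sqrt_lowerBound`, Tardos 1988 / Jukna 2012 Thm. 9.26).

## References

* N. Alon, R. B. Boppana, *The monotone circuit complexity of Boolean functions*,
  Combinatorica 7 (1987) 1–22: Thm. 2.1, Cor. 3.3, Lemma 3.13, Lemma 3.14, §3.4
  [AlonBoppana1987].
* S. Jukna, *Boolean Function Complexity* (2012), Thm. 9.26 (PDF p. 283) [Jukna2012].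
-/

namespace Literature.Computability.Complexity

open Finset GateList Razborov

variable {m : ℕ}

/-! ### Binomial monotonicity along the diagonal -/

/-- `C(n, k) ≤ C(n + d, k + d)` (iterate Pascal's rule). [folklore] -/
theorem choose_le_choose_add_add (n k : ℕ) : ∀ d : ℕ, n.choose k ≤ (n + d).choose (k + d)
  | 0 => le_rfl
  | d + 1 => by
    calc n.choose k ≤ (n + d).choose (k + d) := choose_le_choose_add_add n k d
      _ ≤ (n + d).choose (k + d) + (n + d).choose (k + d + 1) := Nat.le_add_right _ _
      _ = (n + d + 1).choose (k + d + 1) := (Nat.choose_succ_succ' (n + d) (k + d)).symm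
      _ = (n + (d + 1)).choose (k + (d + 1)) := by rw [Nat.add_assoc, Nat.add_assoc]

/-- The number `C(m - j, s - j)` of `s`-sets containing a fixed `j`-set is antitone in `j`
(for `j ≤ s ≤ m`). [folklore] -/
theorem choose_sub_le_choose_sub {m s j j' : ℕ} (hj : j' ≤ j) (hjs : j ≤ s) (hsm : s ≤ m) :
    (m - j).choose (s - j) ≤ (m - j').choose (s - j') := by
  have h1 : m - j' = (m - j) + (j - j') := by omega
  have h2 : s - j' = (s - j) + (j - j') := by omega
  rw [h1, h2]
  exact choose_le_choose_add_add _ _ _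

/-! ### Lost cliques at an AND gate for `l < s` (Alon–Boppana 1987, Lemma 3.13) -/

/-- **Lost cliques of an approximate AND, wide regime** (Alon–Boppana 1987, Lemma 3.13, first
half of the proof, with Cor. 3.3): for closed `A, B ∈ K(m, r, l)` (any `l, s`; of interest for
`l < s`), an `s`-clique `Z` accepted by `⌈A⌉` and `⌈B⌉` but not by `⌈A ∩ B⌉` contains `X ∪ Y`
for minimal members `X ∈ A`, `Y ∈ B` with `|X ∪ Y| > l` (if `|X ∪ Y| ≤ l` then
`X ∪ Y ∈ A ∩ B` by upward closure), and a set of more than `l` vertices lies in at most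
`C(m - l - 1, s - l - 1)` `s`-sets; hence at most `((r-1)^l)^2 · C(m - l - 1, s - l - 1)`
cliques are lost. [cite: AlonBoppana1987, Lemma 3.13] -/
theorem card_errPos_le_wide {r l s : ℕ} (hr : 2 ≤ r)
    {A B : Finset (Finset (Fin m))} (hA : IsClosedFamily r l A) (hB : IsClosedFamily r l B) :
    #(errPos s A B) ≤ ((r - 1) ^ l) ^ 2 * (m - (l + 1)).choose (s - (l + 1)) := by
  classical
  set Q := (m - (l + 1)).choose (s - (l + 1)) with hQ
  -- no `s`-sets at all if `s > m`
  by_cases hsm : s ≤ m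
  swap
  · have hempty : errPos s A B = ∅ := by
      rw [errPos, powersetCard_eq_empty.2 (by rw [card_univ, Fintype.card_fin]; omega)]
      simp
    simp [hempty]
  -- if one family contains `∅` there is no error at all
  by_cases h0A : ∅ ∈ A
  · have hAB : A ∩ B = B := by
      rw [hA.eq_smallSets_of_empty_mem h0A]
      exact inter_eq_right.2 hB.subset
    rw [errPos, filter_false_of_mem, card_empty]
    · exact Nat.zero_le _
    · intro Z _ h
      rw [hAB] at h
      exact h.2.2 h.2.1
  by_cases h0B : ∅ ∈ B
  · have hAB : A ∩ B = A := by
      rw [hB.eq_smallSets_of_empty_mem h0B]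
      exact inter_eq_left.2 hA.subset
    rw [errPos, filter_false_of_mem, card_empty]
    · exact Nat.zero_le _
    · intro Z _ h
      rw [hAB] at h
      exact h.2.2 h.1
  -- otherwise every error contains `X ∪ Y`, `|X ∪ Y| > l`, for minimal members
  set fiber : Finset (Fin m) × Finset (Fin m) → Finset (Finset (Fin m)) := fun p =>
    (powersetCard s (univ : Finset (Fin m))).filter fun Z => p.1 ∪ p.2 ⊆ Z ∧ l < #(p.1 ∪ p.2)
    with hfiber_def
  have hcover : errPos s A B ⊆ (minimals A ×ˢ minimals B).biUnion fiber := by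
    intro Z hZ
    obtain ⟨hZs, ⟨X, hXA, hXP⟩, ⟨Y, hYB, hYP⟩, hnot⟩ := mem_errPos.1 hZ
    have hX1 : #X ≠ 1 := (mem_smallSets.1 (hA.subset hXA)).2
    have hY1 : #Y ≠ 1 := (mem_smallSets.1 (hB.subset hYB)).2
    rw [cliquePresent_cliqueVec_iff hX1] at hXP
    rw [cliquePresent_cliqueVec_iff hY1] at hYP
    obtain ⟨X', hX', hX'X⟩ := exists_minimal_subset hXA
    obtain ⟨Y', hY', hY'Y⟩ := exists_minimal_subset hYB
    have hX'A : X' ∈ A := minimals_subset A hX'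
    have hY'B : Y' ∈ B := minimals_subset B hY'
    have hX'1 : #X' ≠ 1 := (mem_smallSets.1 (hA.subset hX'A)).2
    have hX'0 : X' ≠ ∅ := fun h => h0A (h ▸ hX'A)
    have hX'2 : 2 ≤ #X' := by
      have := card_ne_zero.2 (nonempty_iff_ne_empty.2 hX'0)
      omega
    have hUZ : X' ∪ Y' ⊆ Z := union_subset (hX'X.trans hXP) (hY'Y.trans hYP)
    have hU2 : 2 ≤ #(X' ∪ Y') := hX'2.trans (card_le_card subset_union_left)
    have hbig : l < #(X' ∪ Y') := by
      by_contra hle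
      push Not at hle
      have hsmall : X' ∪ Y' ∈ smallSets (Fin m) l := mem_smallSets.2 ⟨hle, by omega⟩
      have hUA : X' ∪ Y' ∈ A := hA.mem_of_subset hX'A subset_union_left hsmall
      have hUB : X' ∪ Y' ∈ B := hB.mem_of_subset hY'B subset_union_right hsmall
      exact hnot ⟨X' ∪ Y', mem_inter.2 ⟨hUA, hUB⟩,
        (cliquePresent_cliqueVec_iff (by omega)).2 hUZ⟩
    refine mem_biUnion.2 ⟨(X', Y'), mem_product.2 ⟨hX', hY'⟩, ?_⟩
    exact mem_filter.2 ⟨mem_powersetCard.2 ⟨subset_univ _, hZs⟩, hUZ, hbig⟩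
  -- each fibre has at most `Q` elements
  have hfiber : ∀ p ∈ minimals A ×ˢ minimals B, #(fiber p) ≤ Q := by
    intro p _
    by_cases hbig : l < #(p.1 ∪ p.2)
    · by_cases hUs : #(p.1 ∪ p.2) ≤ s
      · have heq : fiber p = (powersetCard s (univ : Finset (Fin m))).filter
            fun Z => p.1 ∪ p.2 ⊆ Z := by
          refine filter_congr fun Z _ => ?_
          exact ⟨fun h => h.1, fun h => ⟨h, hbig⟩⟩
        calc #(fiber p) = #((powersetCard s (univ : Finset (Fin m))).filter
              fun Z => p.1 ∪ p.2 ⊆ Z) := by rw [heq]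
          _ ≤ (#(univ : Finset (Fin m)) - #(p.1 ∪ p.2)).choose (s - #(p.1 ∪ p.2)) :=
              card_filter_supset_powersetCard_le univ _ hUs
          _ = (m - #(p.1 ∪ p.2)).choose (s - #(p.1 ∪ p.2)) := by
              rw [card_univ, Fintype.card_fin]
          _ ≤ Q := choose_sub_le_choose_sub (Nat.succ_le_of_lt hbig) hUs hsm
      · -- no `s`-set contains a set of more than `s` vertices
        have hempty : fiber p = ∅ := by
          refine filter_false_of_mem fun Z hZ h => hUs ?_
          rw [← (mem_powersetCard.1 hZ).2]
          exact card_le_card h.1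
        rw [hempty, card_empty]
        exact Nat.zero_le _
    · have hempty : fiber p = ∅ := filter_false_of_mem fun Z _ h => hbig h.2
      rw [hempty, card_empty]
      exact Nat.zero_le _
  calc #(errPos s A B) ≤ #((minimals A ×ˢ minimals B).biUnion fiber) := card_le_card hcover
    _ ≤ ∑ p ∈ minimals A ×ˢ minimals B, #(fiber p) := card_biUnion_le
    _ ≤ ∑ _p ∈ minimals A ×ˢ minimals B, Q := sum_le_sum hfiber
    _ = #(minimals A) * #(minimals B) * Q := by rw [sum_const, smul_eq_mul, card_product]
    _ ≤ (r - 1) ^ l * (r - 1) ^ l * Q :=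
        Nat.mul_le_mul_right _ (Nat.mul_le_mul (hA.card_minimals_le hr) (hB.card_minimals_le hr))
    _ = ((r - 1) ^ l) ^ 2 * Q := by rw [sq]

/-! ### Razborov's theorem along a straight-line program, wide regime -/

/-- **Approximating a whole monotone program, wide regime** (Alon–Boppana 1987, proof of
Thm. 2.1 in the lattice `K(m, r, l)`, `2 ≤ r`, `2 ≤ l < s`): as `exists_rApprox_gates`, with at
most `((r-1)^l)^2 · C(m - l - 1, s - l - 1)` lost `s`-cliques per gate
(`card_errPos_le_wide`). [cite: AlonBoppana1987, Thm. 2.1] -/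
theorem exists_rApprox_gates_wide {r l s g : ℕ} (hr : 2 ≤ r) (hl : 2 ≤ l) :
    ∀ gs : List (Gate (KEdge m)), WF gs → (∀ gt ∈ gs, gt.fn ∈ monotoneBasis) →
      ∃ (ap : KEdge m ⊕ ℕ → Finset (Finset (Fin m))) (BadZ : Finset (Finset (Fin m)))
        (BadO : Finset (Fin m → Fin g)),
        #BadZ ≤ gs.length * (((r - 1) ^ l) ^ 2 * (m - (l + 1)).choose (s - (l + 1))) ∧
        #BadO * (g ^ l) ^ r ≤ gs.length * (#(smallSets (Fin m) l) * ((g ^ l - g.descFactorial l) ^ r * g ^ m)) ∧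
        ∀ w : KEdge m ⊕ ℕ, OutOK gs.length w →
          RApprox r l s g BadZ BadO (ap w) (fun x => wireOf x (vals gs x) w) := by
  intro gs
  induction gs using List.reverseRecOn with
  | nil =>
    intro _ _
    refine ⟨fun w => match w with
      | .inl e => inputFamily l e
      | .inr _ => ∅, ∅, ∅, by simp, by simp, fun w hw => ?_⟩
    rcases w with e | n
    · exact RApprox.input hr hl e
    · exact absurd (hw n rfl) (by simp)
  | append_singleton gs gt ih =>
    intro hwf hB
    obtain ⟨ap, BadZ, BadO, hcZ, hcO, hinv⟩ :=
      ih hwf.of_append_left fun g' hg' => hB g' (List.mem_append_left _ hg')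
    have hgOK : GateOK gs.length gt := hwf.gateOK_mid (post := [])
    have hgB : gt.fn ∈ monotoneBasis := hB gt (by simp)
    set P := ((r - 1) ^ l) ^ 2 * (m - (l + 1)).choose (s - (l + 1)) with hP
    set Q := #(smallSets (Fin m) l) * ((g ^ l - g.descFactorial l) ^ r * g ^ m) with hQ
    -- old wires keep their values and invariants
    have hold : ∀ (BadZ' : Finset (Finset (Fin m))) (BadO' : Finset (Fin m → Fin g)),
        BadZ ⊆ BadZ' → BadO ⊆ BadO' → ∀ w : KEdge m ⊕ ℕ, OutOK gs.length w →
        RApprox r l s g BadZ' BadO' (ap w) (fun x => wireOf x (vals (gs ++ [gt]) x) w) :=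
      fun BadZ' BadO' hZ hO w hw =>
        ((hinv w hw).mono hZ hO).congr fun x => (wireOf_vals_append gs [gt] x w hw).symm
    -- the value of the new gate
    have hnew : ∀ x, wireOf x (vals (gs ++ [gt]) x) (.inr gs.length) =
        gt.op (fun a => wireOf x (vals gs x) (gt.args a)) := fun x => by
      rw [wireOf_inr, show gs ++ [gt] = gs ++ gt :: [] from rfl, getD_vals_append_cons]
    -- how to assemble the conclusion from an approximator of the new gate
    have assemble : ∀ (BadZ' : Finset (Finset (Fin m))) (BadO' : Finset (Fin m → Fin g))
        (Fn : Finset (Finset (Fin m))),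
        BadZ ⊆ BadZ' → BadO ⊆ BadO' → #BadZ' ≤ (gs ++ [gt]).length * P →
        #BadO' * (g ^ l) ^ r ≤ (gs ++ [gt]).length * Q →
        RApprox r l s g BadZ' BadO' Fn (fun x => wireOf x (vals (gs ++ [gt]) x) (.inr gs.length)) →
        ∃ (ap : KEdge m ⊕ ℕ → Finset (Finset (Fin m))) (BadZ : Finset (Finset (Fin m)))
          (BadO : Finset (Fin m → Fin g)),
          #BadZ ≤ (gs ++ [gt]).length * P ∧ #BadO * (g ^ l) ^ r ≤ (gs ++ [gt]).length * Q ∧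
          ∀ w : KEdge m ⊕ ℕ, OutOK (gs ++ [gt]).length w →
            RApprox r l s g BadZ BadO (ap w) (fun x => wireOf x (vals (gs ++ [gt]) x) w) := by
      intro BadZ' BadO' Fn hZZ' hOO' hcZ' hcO' hnewinv
      refine ⟨fun w => if w = .inr gs.length then Fn else ap w, BadZ', BadO', hcZ', hcO',
        fun w hw => ?_⟩
      by_cases hwn : w = .inr gs.length
      · subst hwn
        simpa using hnewinv
      · dsimp only
        rw [if_neg hwn]
        refine hold BadZ' BadO' hZZ' hOO' w fun n hn => ?_
        have h1 := hw n hn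
        simp only [List.length_append, List.length_singleton] at h1
        have h2 : n ≠ gs.length := fun h => hwn (hn.trans (by rw [h]))
        omega
    have hlen : (gs ++ [gt]).length = gs.length + 1 := by simp
    simp only [monotoneBasis, Set.mem_insert_iff, Set.mem_singleton_iff] at hgB
    rcases hgB with hc | hc
    · -- AND gate
      obtain ⟨u, v, rfl⟩ := exists_eq_andGate_of_fn_eq hc
      have hu : OutOK gs.length u := fun n hn => hgOK (0 : Fin 2) n hn
      have hv : OutOK gs.length v := fun n hn => hgOK (1 : Fin 2) n hn
      have hnewinv := RApprox.and_gate (hinv u hu) (hinv v hv)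
      have hcZ' : #(BadZ ∪ errPos s (ap u) (ap v)) ≤ (gs.length + 1) * P :=
        calc #(BadZ ∪ errPos s (ap u) (ap v)) ≤ #BadZ + #(errPos s (ap u) (ap v)) :=
              card_union_le _ _
          _ ≤ gs.length * P + P :=
              Nat.add_le_add hcZ (card_errPos_le_wide hr (hinv u hu).closed (hinv v hv).closed)
          _ = (gs.length + 1) * P := by ring
      refine assemble (BadZ ∪ errPos s (ap u) (ap v)) BadO _ subset_union_left Subset.rfl
        (by rw [hlen]; exact hcZ') (hcO.trans (Nat.mul_le_mul_right _ (by simp)))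
        (hnewinv.congr fun x => ?_)
      rw [hnew, andGate_op]
    · -- OR gate
      obtain ⟨u, v, rfl⟩ := exists_eq_orGate_of_fn_eq hc
      have hu : OutOK gs.length u := fun n hn => hgOK (0 : Fin 2) n hn
      have hv : OutOK gs.length v := fun n hn => hgOK (1 : Fin 2) n hn
      have hnewinv := RApprox.or_gate (hinv u hu) (hinv v hv)
      have hsub : ap u ∪ ap v ⊆ smallSets (Fin m) l :=
        union_subset (hinv u hu).closed.subset (hinv v hv).closed.subset
      have herr : #(errNeg g r l (ap u ∪ ap v)) * (g ^ l) ^ r ≤ Q :=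
        (card_errNeg_mul_le hsub).trans (Nat.mul_le_mul_right _ (card_le_card sdiff_subset))
      have hcO' : #(BadO ∪ errNeg g r l (ap u ∪ ap v)) * (g ^ l) ^ r ≤ (gs.length + 1) * Q :=
        calc #(BadO ∪ errNeg g r l (ap u ∪ ap v)) * (g ^ l) ^ r
            ≤ (#BadO + #(errNeg g r l (ap u ∪ ap v))) * (g ^ l) ^ r :=
              Nat.mul_le_mul_right _ (card_union_le _ _)
          _ = #BadO * (g ^ l) ^ r + #(errNeg g r l (ap u ∪ ap v)) * (g ^ l) ^ r := by ring
          _ ≤ gs.length * Q + Q := Nat.add_le_add hcO herr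
          _ = (gs.length + 1) * Q := by ring
      refine assemble BadZ (BadO ∪ errNeg g r l (ap u ∪ ap v)) _ Subset.rfl subset_union_left
        (hcZ.trans (Nat.mul_le_mul_right _ (by simp))) (by rw [hlen]; exact hcO')
        (hnewinv.congr fun x => ?_)
      rw [hnew, orGate_op]

/-- **Razborov's theorem for CLIQUE-type circuits, wide regime** (Alon–Boppana 1987, Thm. 2.1
in `K(m, r, l)`, `2 ≤ r`, `2 ≤ l < s`): a circuit of size `t` over `{∧₂, ∨₂}` computing `f`
has a closed family `F` such that every `s`-clique accepted by `f` is accepted by `⌈F⌉` up to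
at most `t · ((r-1)^l)^2 · C(m - l - 1, s - l - 1)` lost cliques, and every colouring accepted
by `⌈F⌉` is accepted by `f` up to a set `BadO` with
`#BadO · (g^l)^r ≤ t · |𝒱(l)| · (g^l - g(g-1)⋯(g-l+1))^r · g^m`. [cite: AlonBoppana1987, Thm. 2.1] -/
theorem exists_rApprox_circuit_wide {r l s g : ℕ} (hr : 2 ≤ r) (hl : 2 ≤ l)
    (C : Circuit (KEdge m)) (hC : C.IsOver monotoneBasis) {f : (KEdge m → Bool) → Bool}
    (hf : C.Computes f) :
    ∃ (F : Finset (Finset (Fin m))) (BadZ : Finset (Finset (Fin m))) (BadO : Finset (Fin m → Fin g)),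
      IsClosedFamily r l F ∧
      #BadZ ≤ C.size * (((r - 1) ^ l) ^ 2 * (m - (l + 1)).choose (s - (l + 1))) ∧
      #BadO * (g ^ l) ^ r ≤ C.size * (#(smallSets (Fin m) l) * ((g ^ l - g.descFactorial l) ^ r * g ^ m)) ∧
      (∀ Z : Finset (Fin m), #Z = s → f (cliqueVec Z) = true → Accepts F (cliqueVec Z) ∨ Z ∈ BadZ) ∧
      (∀ O : Fin m → Fin g, Accepts F (colorVec O) → f (colorVec O) = true ∨ O ∈ BadO) := by
  obtain ⟨ap, BadZ, BadO, hcZ, hcO, hinv⟩ :=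
    exists_rApprox_gates_wide (g := g) hr hl C.gates (wf_gates C) hC
  have h := hinv C.output C.wf_output
  refine ⟨ap C.output, BadZ, BadO, h.closed, hcZ, hcO, fun Z hZs hZ => h.pos Z hZs ?_,
    fun O hO => ?_⟩
  · rw [← hZ, ← hf, circuit_eval]
  · have := h.neg O hO
    rwa [← circuit_eval, hf] at this

/-! ### The dichotomy, wide regime (Alon–Boppana 1987, §3.3–3.4) -/

/-- **Razborov–Alon–Boppana dichotomy for large cliques** (Alon–Boppana 1987, proof of
Lemma 3.14 / §3.4 with a general lattice parameter `2 ≤ l < s`, constants not optimised). Let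
`r ≥ 2`, and let a circuit of size `t` over `{∧₂, ∨₂}` compute a function `f` on the edges of
`K_m` accepting every `s`-clique and rejecting the complete multipartite graph of every
`g`-colouring. Then either (the approximator contains `∅` and accepts everything)
`g^m · (g^l)^r ≤ t · |𝒱(l)| · (g^l - g(g-1)⋯(g-l+1))^r · g^m`, or every `s`-clique is lost or
contains a minimal member of the approximator, whence
`C(m, s) ≤ t · ((r-1)^l)^2 · C(m-l-1, s-l-1) + Σ_{k=2}^{l} (r-1)^k · C(m-k, s-k)` (Cor. 3.3,
Lemma 3.13). For `s = l + 1` this is `razborov_dichotomy`. [cite: AlonBoppana1987, Lemma 3.14] -/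
theorem razborov_dichotomy_wide {r l s g : ℕ} (hr : 2 ≤ r) (hl : 2 ≤ l) (hls : l < s)
    (C : Circuit (KEdge m)) (hC : C.IsOver monotoneBasis) {f : (KEdge m → Bool) → Bool}
    (hf : C.Computes f) (hpos : ∀ Z : Finset (Fin m), #Z = s → f (cliqueVec Z) = true)
    (hneg : ∀ O : Fin m → Fin g, f (colorVec O) = false) :
    g ^ m * (g ^ l) ^ r ≤ C.size * (#(smallSets (Fin m) l) * ((g ^ l - g.descFactorial l) ^ r * g ^ m)) ∨
    m.choose s ≤ C.size * (((r - 1) ^ l) ^ 2 * (m - (l + 1)).choose (s - (l + 1))) +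
      ∑ k ∈ Icc 2 l, (r - 1) ^ k * (m - k).choose (s - k) := by
  classical
  obtain ⟨F, BadZ, BadO, hF, hcZ, hcO, hposF, hnegF⟩ :=
    exists_rApprox_circuit_wide (g := g) hr hl C hC hf
  by_cases h0 : ∅ ∈ F
  · -- Case 2: the approximator accepts every colouring, so all colourings are bad
    left
    have hall : (univ : Finset (Fin m → Fin g)) ⊆ BadO := fun O _ => by
      rcases hnegF O (accepts_of_empty_mem h0 _) with h | h
      · rw [hneg O] at h
        exact absurd h Bool.false_ne_true
      · exact h
    have hcard : g ^ m ≤ #BadO := by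
      have := card_le_card hall
      rwa [card_univ, Fintype.card_fun, Fintype.card_fin, Fintype.card_fin] at this
    exact (Nat.mul_le_mul_right _ hcard).trans hcO
  · -- Case 1: every `s`-clique is lost or contains a minimal member of `F`
    right
    have hcover : powersetCard s (univ : Finset (Fin m)) ⊆
        BadZ ∪ (minimals F).biUnion fun M => (powersetCard s univ).filter fun Z => M ⊆ Z := by
      intro Z hZ
      have hZs : #Z = s := (mem_powersetCard.1 hZ).2
      rcases hposF Z hZs (hpos Z hZs) with ⟨W, hW, hP⟩ | h
      · rw [cliquePresent_cliqueVec_iff (mem_smallSets.1 (hF.subset hW)).2] at hP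
        obtain ⟨M, hM, hMW⟩ := exists_minimal_subset hW
        exact mem_union_right _ (mem_biUnion.2 ⟨M, hM, mem_filter.2 ⟨hZ, hMW.trans hP⟩⟩)
      · exact mem_union_left _ h
    -- minimal members have between `2` and `l` elements
    have hMcard : ∀ M ∈ minimals F, #M ∈ Icc 2 l := by
      intro M hM
      have hMF := minimals_subset F hM
      have h := mem_smallSets.1 (hF.subset hMF)
      have hM0 : #M ≠ 0 := fun hc => h0 (card_eq_zero.1 hc ▸ hMF)
      exact mem_Icc.2 ⟨by omega, h.1⟩
    calc m.choose s = #(powersetCard s (univ : Finset (Fin m))) := by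
          rw [card_powersetCard, card_univ, Fintype.card_fin]
      _ ≤ #BadZ + #((minimals F).biUnion fun M => (powersetCard s univ).filter fun Z => M ⊆ Z) :=
          (card_le_card hcover).trans (card_union_le _ _)
      _ ≤ C.size * (((r - 1) ^ l) ^ 2 * (m - (l + 1)).choose (s - (l + 1))) +
            ∑ M ∈ minimals F, (m - #M).choose (s - #M) := by
          refine Nat.add_le_add hcZ (card_biUnion_le.trans (sum_le_sum fun M hM => ?_))
          have hMs : #M ≤ s := by have := (mem_Icc.1 (hMcard M hM)).2; omega
          have h := card_filter_supset_powersetCard_le (univ : Finset (Fin m)) M hMs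
          rwa [card_univ, Fintype.card_fin] at h
      _ = C.size * (((r - 1) ^ l) ^ 2 * (m - (l + 1)).choose (s - (l + 1))) +
            ∑ k ∈ Icc 2 l, ∑ M ∈ (minimals F).filter (fun M => #M = k), (m - #M).choose (s - #M) := by
          rw [sum_fiberwise_of_maps_to hMcard]
      _ = C.size * (((r - 1) ^ l) ^ 2 * (m - (l + 1)).choose (s - (l + 1))) +
            ∑ k ∈ Icc 2 l, #((minimals F).filter fun M => #M = k) * (m - k).choose (s - k) := by
          congr 1
          refine sum_congr rfl fun k _ => ?_
          rw [sum_congr rfl fun M hM => by rw [(mem_filter.1 hM).2], sum_const, smul_eq_mul]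
      _ ≤ C.size * (((r - 1) ^ l) ^ 2 * (m - (l + 1)).choose (s - (l + 1))) +
            ∑ k ∈ Icc 2 l, (r - 1) ^ k * (m - k).choose (s - k) := by
          refine Nat.add_le_add_left (sum_le_sum fun k _ => Nat.mul_le_mul_right _ ?_) _
          calc #((minimals F).filter fun M => #M = k)
              ≤ #((minimals F).filter fun M => #M ≤ k) :=
                card_le_card (monotone_filter_right _ fun M _ (h : #M = k) => h.le)
            _ ≤ (r - 1) ^ k := hF.card_minimals_filter_le hr k

end Literature.Computability.Complexity
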